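import Literature.AlgebraicGeometry.HodgeTheory.HodgeClassesDimLEThreeOfGAGA
import Literature.AlgebraicGeometry.HodgeTheory.HardLefschetzNFoldHolds
import HarnessLib

/-!
# `nonempty_hardLefschetzThreefold` holds (discharge of the named fact)

Family `hodge`, layer `Literature/AlgebraicGeometry/HodgeTheory`. Theorems-only companion (no
definition, no named fact; D-0026) of `HardLefschetzThreefold` (the named fact
`nonempty_hardLefschetzThreefold X`: Voisin, *Hodge Theory and Complex Algebraic Geometry II*, proof of
Prop. 10.26 — a smooth projective complex threefold carries the Lefschetz isomorphism
`L = [H] ∪ · : H²(X, ℚ) ≅ H⁴(X, ℚ)` of an ample class, rational, supported on the divisor `H`, of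
bidegree `(1,1)`, mapping divisor classes to curve classes). The tree has since PROVED the `n`-fold
version `nonempty_hardLefschetzNFold_holds` (file `HardLefschetzNFoldHolds`: the hard Lefschetz datum of
a rational multiple of the hyperplane class, Voisin I Thm. 6.25 / Rem. 6.27 / §7.1.2 with the rationality
of `[ω_FS|_X]`), and the specialisation `nonempty_hardLefschetzThreefold_of_nFold`
(file `HodgeClassesDimLEThreeOfGAGA`, via `HardLefschetzNFold.toThreefold`); this file records the
discharge `nonempty_hardLefschetzThreefold_holds`, so that the consumers taking
`(h : nonempty_hardLefschetzThreefold X)` / `(h4 : ∀ X, nonempty_hardLefschetzThreefold X)`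
(`HodgeClassesDimLEThreeProofs`, `HardLefschetzThreefold`'s own corollaries) become unconditional by name.

References: [VoisinHodgeI2002] Thm. 6.25, Rem. 6.27, §7.1.2, Thm. 7.10; [VoisinHodgeII2003] §10.2.3,
proof of Prop. 10.26, §9.2.4 Prop. 9.20.
-/

noncomputable section

namespace Literature.AlgebraicGeometry.HodgeTheory

section HodgeTheory

variable {X : Motives.SchemeOver ℂ}

/-- **`nonempty_hardLefschetzThreefold X` holds** for every complex scheme `X` (the fact is guarded by
`IsSmoothProjective 3 X`): the `n`-fold hard Lefschetz datum at `n = 3`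
(`nonempty_hardLefschetzNFold_holds 3 X`) specialised to the threefold structure
(`nonempty_hardLefschetzThreefold_of_nFold`). [cite: VoisinHodgeI2002, Thm. 6.25, Rem. 6.27 and §7.1.2]
[cite: VoisinHodgeII2003, §10.2.3 proof of Prop. 10.26] -/
theorem nonempty_hardLefschetzThreefold_holds : nonempty_hardLefschetzThreefold X :=
  nonempty_hardLefschetzThreefold_of_nFold (nonempty_hardLefschetzNFold_holds 3 X)

/-- All smooth projective threefolds at once, in the binder shape `∀ X, nonempty_hardLefschetzThreefold X`
consumed by `hodgeClasses_algebraic_of_dim_le_three_of` (file `HodgeClassesDimLEThreeProofs`).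
[cite: VoisinHodgeII2003, §10.2.3 proof of Prop. 10.26] -/
theorem forall_nonempty_hardLefschetzThreefold_holds :
    ∀ Y : Motives.SchemeOver ℂ, nonempty_hardLefschetzThreefold Y :=
  fun _ ↦ nonempty_hardLefschetzThreefold_holds

end HodgeTheory

end Literature.AlgebraicGeometry.HodgeTheory

end
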